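import Summits.Ventures.PercRepro.ProfileMixedStep

/-!
# PercRepro — the LOOP case of the clean inductive step (p10, gen 0; S5, Proposition 2 (C))

`ProfileMixedStep.lean` proves the clean inductive step of the mixed-antichain profile-Hall form `MAS` for a NON-LOOP
`e`.  For a LOOP `e` the two regimes are simpler and need only `MAS (M ＼ {e}) u`: inserting or erasing a loop keeps
every rank (`rk_insert_of_isLoop`, `rk_erase_of_isLoop`), so every price is unchanged (`pi_delete_of_isLoop`,
`pi_delete_erase_of_isLoop`) and the rank-`u` sets above `𝒜` containing `e` correspond by `S ↦ S ∖ {e}` to the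
rank-`u` sets of `M ＼ {e}` above `𝒜.image (·.erase e)` (`card_shadowLevel_filter_mem_of_isLoop`):

* `mas_step_of_isLoop_notMem` — `e` in no member: the shadow doubles, `#∂_u 𝒜 = 2·#∂^{M＼e}_u 𝒜 ≥ 2·Σ pi ≥ Σ pi`;
* `mas_step_of_isLoop_mem` — `e` in every member: `#∂_u 𝒜 = #∂^{M＼e}_u (𝒜 ∖ e)` and the prices agree.
With `mas_step_of_notMem` / `mas_step_of_mem` this is Proposition 2 of `proofs/SUBCLAIM-S5-p10.md` in full.
-/

/-! ## The loop case of Proposition 2 (C): a loop `e` doubles the shadow and keeps every price -/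

open scoped Matroid

namespace PercRepro.Skew

open Finset ThmH Shadow Profile

variable {α : Type} [DecidableEq α] {M : Matroid α} [M.Finite] {e : α} {u : ℕ}

/-- Inserting a loop does not change the rank. -/
theorem rk_insert_of_isLoop (he : M.IsLoop e) {X : Finset α} (hX : X ⊆ gr M) : rk M (insert e X) = rk M X := by
  unfold rk
  rw [Finset.coe_insert, eRk_insert_eq_of_mem_closure (by rw [← coe_gr]; exact_mod_cast hX) (he.mem_closure _)]

/-- Erasing a loop does not change the rank. -/
theorem rk_erase_of_isLoop (he : M.IsLoop e) {X : Finset α} (hX : X ⊆ gr M) : rk M (X.erase e) = rk M X := by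
  by_cases heX : e ∈ X
  · conv_rhs => rw [← Finset.insert_erase heX]
    rw [rk_insert_of_isLoop he (Finset.erase_subset_erase e hX |>.trans (Finset.erase_subset e _))]
  · rw [Finset.erase_eq_of_notMem heX]

/-- The price of a set avoiding a loop `e` is the same in `M ＼ {e}`. -/
theorem pi_delete_of_isLoop (he : M.IsLoop e) {B : Finset α} (hB : B ⊆ (gr M).erase e) :
    pi (M ＼ ({e} : Set α)) u B = pi M u B := by
  unfold pi
  rw [rk_delete hB, gr_delete', erase_sdiff, rk_delete (Finset.erase_subset_erase e Finset.sdiff_subset),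
    rk_erase_of_isLoop he Finset.sdiff_subset]

/-- The price of a set containing a loop `e` is the price of `B ∖ {e}` in `M ＼ {e}`. -/
theorem pi_delete_erase_of_isLoop (he : M.IsLoop e) {B : Finset α} (hB : B ⊆ gr M) (heB : e ∈ B) :
    pi (M ＼ ({e} : Set α)) u (B.erase e) = pi M u B := by
  have heC : e ∉ gr M \ B := fun h => (Finset.mem_sdiff.1 h).2 heB
  unfold pi
  rw [rk_delete (Finset.erase_subset_erase e hB), rk_erase_of_isLoop he hB, gr_delete', Shadow.erase_sdiff_erase,
    Finset.erase_eq_of_notMem heC, rk_delete (Finset.subset_erase.2 ⟨Finset.sdiff_subset, heC⟩)]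

/-- For a loop `e`, the rank-`u` sets above `𝒜` containing `e` correspond to the rank-`u` sets of `M ＼ {e}` above
`𝒜.image (·.erase e)`. -/
theorem card_shadowLevel_filter_mem_of_isLoop (he : M.IsLoop e) (𝒜 : Finset (Finset α)) :
    ((shadowLevel M u 𝒜).filter (fun S => e ∈ S)).card =
      (shadowLevel (M ＼ ({e} : Set α)) u (𝒜.image (fun B => B.erase e))).card := by
  have heE : e ∈ gr M := by rw [← Finset.mem_coe, coe_gr]; exact he.mem_ground
  apply Finset.card_nbij' (fun S => S.erase e) (fun T => insert e T)
  · intro S hS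
    rw [Finset.mem_coe, Finset.mem_filter, mem_shadowLevel] at hS
    obtain ⟨⟨⟨hSg, hSu⟩, B, hB, hBS⟩, heS⟩ := hS
    rw [Finset.mem_coe]
    dsimp only
    rw [mem_shadowLevel, gr_delete']
    have hS' : S.erase e ⊆ (gr M).erase e := Finset.erase_subset_erase e hSg
    refine ⟨⟨hS', ?_⟩, B.erase e, Finset.mem_image_of_mem _ hB, Finset.erase_subset_erase e hBS⟩
    have h1 : rk (M ＼ ({e} : Set α)) (S.erase e) = u := by
      rw [rk_delete hS', rk_erase_of_isLoop he hSg]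
      unfold rk; rw [hSu, ENat.toNat_coe]
    rw [← coe_rk, h1]
  · intro T hT
    rw [Finset.mem_coe, mem_shadowLevel, gr_delete'] at hT
    obtain ⟨⟨hTg, hTu⟩, B', hB', hB'T⟩ := hT
    rw [Finset.mem_image] at hB'
    obtain ⟨B, hB, rfl⟩ := hB'
    rw [Finset.mem_coe]
    dsimp only
    rw [Finset.mem_filter, mem_shadowLevel]
    refine ⟨⟨⟨Finset.insert_subset heE (Finset.subset_erase.1 hTg).1, ?_⟩, B, hB, ?_⟩,
      Finset.mem_insert_self _ _⟩
    · have h1 : rk M (insert e T) = u := by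
        rw [rk_insert_of_isLoop he (Finset.subset_erase.1 hTg).1, ← rk_delete hTg]
        unfold rk; rw [hTu, ENat.toNat_coe]
      rw [← coe_rk, h1]
    · intro x hx
      by_cases hxe : x = e
      · subst hxe; exact Finset.mem_insert_self _ _
      · exact Finset.mem_insert_of_mem (hB'T (Finset.mem_erase.2 ⟨hxe, hx⟩))
  · intro S hS
    rw [Finset.mem_coe, Finset.mem_filter] at hS
    dsimp only
    exact Finset.insert_erase hS.2
  · intro T hT
    rw [Finset.mem_coe, mem_shadowLevel, gr_delete'] at hT
    have heT : e ∉ T := fun h => (Finset.mem_erase.1 (hT.1.1 h)).1 rfl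
    dsimp only
    exact Finset.erase_insert heT

/-- **Regime «loop outside every member»**: the shadow doubles, `MAS (M ＼ {e}) u` suffices. -/
theorem mas_step_of_isLoop_notMem (he : M.IsLoop e) (h1 : MAS (M ＼ ({e} : Set α)) u) (𝒜 : Finset (Finset α))
    (h𝒜 : ∀ B ∈ 𝒜, B ⊆ gr M) (hanti : ∀ B ∈ 𝒜, ∀ B' ∈ 𝒜, B ⊆ B' → B = B') (hnot : ∀ B ∈ 𝒜, e ∉ B) :
    ∑ B ∈ 𝒜, pi M u B ≤ ((shadowLevel M u 𝒜).card : ℚ) := by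
  have h𝒜' : ∀ B ∈ 𝒜, B ⊆ (gr M).erase e := fun B hB => Finset.subset_erase.2 ⟨h𝒜 B hB, hnot B hB⟩
  have hd := h1 𝒜 (by rw [gr_delete']; exact h𝒜') hanti
  have himg : 𝒜.image (fun B => B.erase e) = 𝒜 := by
    ext B
    rw [Finset.mem_image]
    constructor
    · rintro ⟨B', hB', rfl⟩
      rw [Finset.erase_eq_of_notMem (hnot B' hB')]
      exact hB'
    · intro hB
      exact ⟨B, hB, Finset.erase_eq_of_notMem (hnot B hB)⟩
  have h2 := card_shadowLevel_filter_mem_of_isLoop (M := M) (u := u) he 𝒜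
  rw [himg] at h2
  have hsplit : (shadowLevel M u 𝒜).card =
      (shadowLevel (M ＼ ({e} : Set α)) u 𝒜).card + (shadowLevel (M ＼ ({e} : Set α)) u 𝒜).card := by
    rw [← Finset.card_filter_add_card_filter_not (s := shadowLevel M u 𝒜) (fun S => e ∉ S),
      shadowLevel_filter_notMem, ← h2]
    congr 2
    ext S
    simp only [Finset.mem_filter, not_not]
  have hsum : ∑ B ∈ 𝒜, pi M u B = ∑ B ∈ 𝒜, pi (M ＼ ({e} : Set α)) u B :=
    Finset.sum_congr rfl (fun B hB => (pi_delete_of_isLoop he (h𝒜' B hB)).symm)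
  rw [hsplit, Nat.cast_add, hsum]
  have hnn : (0 : ℚ) ≤ ((shadowLevel (M ＼ ({e} : Set α)) u 𝒜).card : ℚ) := Nat.cast_nonneg _
  linarith

/-- **Regime «loop inside every member»**: `MAS (M ＼ {e}) u` suffices. -/
theorem mas_step_of_isLoop_mem (he : M.IsLoop e) (h1 : MAS (M ＼ ({e} : Set α)) u) (𝒜 : Finset (Finset α))
    (h𝒜 : ∀ B ∈ 𝒜, B ⊆ gr M) (hanti : ∀ B ∈ 𝒜, ∀ B' ∈ 𝒜, B ⊆ B' → B = B') (hall : ∀ B ∈ 𝒜, e ∈ B) :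
    ∑ B ∈ 𝒜, pi M u B ≤ ((shadowLevel M u 𝒜).card : ℚ) := by
  have hfilt : (shadowLevel M u 𝒜).filter (fun S => e ∈ S) = shadowLevel M u 𝒜 := by
    ext S
    rw [Finset.mem_filter]
    constructor
    · exact fun h => h.1
    · intro hS
      refine ⟨hS, ?_⟩
      obtain ⟨-, B, hB, hBS⟩ := mem_shadowLevel.1 hS
      exact hBS (hall B hB)
  have hcard := card_shadowLevel_filter_mem_of_isLoop (M := M) (u := u) he 𝒜
  rw [hfilt] at hcard
  have hinj : Set.InjOn (fun B => B.erase e) (𝒜 : Set (Finset α)) := by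
    intro B hB B' hB' hBB'
    simp only at hBB'
    rw [← Finset.insert_erase (hall B hB), ← Finset.insert_erase (hall B' hB'), hBB']
  have hc := h1 (𝒜.image (fun B => B.erase e))
    (by
      intro B' hB'
      rw [Finset.mem_image] at hB'
      obtain ⟨B, hB, rfl⟩ := hB'
      rw [gr_delete']
      exact Finset.erase_subset_erase e (h𝒜 B hB))
    (by
      intro B₁ hB₁ B₂ hB₂ hsub
      rw [Finset.mem_image] at hB₁ hB₂
      obtain ⟨B, hB, rfl⟩ := hB₁
      obtain ⟨B', hB', rfl⟩ := hB₂
      have : B ⊆ B' := by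
        intro x hx
        by_cases hxe : x = e
        · subst hxe; exact hall B' hB'
        · exact Finset.mem_of_mem_erase (hsub (Finset.mem_erase.2 ⟨hxe, hx⟩))
      rw [hanti B hB B' hB' this])
  rw [hcard]
  calc ∑ B ∈ 𝒜, pi M u B
      = ∑ B ∈ 𝒜, pi (M ＼ ({e} : Set α)) u (B.erase e) :=
        Finset.sum_congr rfl (fun B hB => (pi_delete_erase_of_isLoop he (h𝒜 B hB) (hall B hB)).symm)
    _ = ∑ B' ∈ 𝒜.image (fun B => B.erase e), pi (M ＼ ({e} : Set α)) u B' := (Finset.sum_image hinj).symm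
    _ ≤ _ := hc

end PercRepro.Skew
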